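import Literature.AlgebraicGeometry.Modules.PullbackTensorProductHolds
import Literature.AlgebraicGeometry.Modules.TensorSheafHomAdjunction
import Literature.AlgebraicGeometry.Modules.TensorUnitors
import Literature.AlgebraicGeometry.Modules.QuasicoherentAbelian
import Literature.AlgebraicGeometry.Modules.PullbackQuasicoherent
import Mathlib.AlgebraicGeometry.Modules.Tilde
import Mathlib.CategoryTheory.Limits.Preserves.Shapes.Kernels
import Mathlib.CategoryTheory.Limits.Preserves.Shapes.Products
import HarnessLib

/-!
# The tensor product of two quasi-coherent `𝒪_X`-modules is quasi-coherent (Stacks 01CE (5) / 01LA, 01I8)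

Layer `Literature/AlgebraicGeometry/Modules` (0 definitions, 0 named facts, no instances declared — the
quasi-coherence results are stated as theorems —, no notation). For `𝒪_X`-modules `M`, `N` on a scheme `X`
(Mathlib's `X.Modules`), the tree's sheafified tensor product `Modules.tensorObj M N` (Stacks 01CA,
`Modules/TensorProduct`) is QUASI-COHERENT when `M` and `N` are (Mathlib's `SheafOfModules.IsQuasicoherent`,
equivalently the tree's `IsAffineLocalizing`, `Modules/QuasicoherentAbelian.isQuasicoherent_iff_isAffineLocalizing`):

The Stacks Project, Tag 01LA (Schemes, Lemma 26.24.1 in the current numbering; also Modules, Lemma 17.16.6 = 01CE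
and Schemes, Lemma 26.7.? = 01I8 (1) "`M~ ⊗_{𝒪_X} N~ = (M ⊗_R N)~`"): "Let `X` be a scheme. … any direct sum of
quasi-coherent sheaves is quasi-coherent … (5) Given two quasi-coherent `𝒪_X`-modules the tensor product is
quasi-coherent"; Hartshorne, *Algebraic Geometry* II Cor. 5.7 context / Prop. 5.2 (b) "`(M ⊗_A N)~ ≅ M~ ⊗ N~`".

The proof typed here is the categorical one (no sections are computed): on an AFFINE scheme `Spec R` every
quasi-coherent module is `Γ(N)~` (Mathlib `Scheme.Modules.isIso_fromTildeΓ_of_isQuasicoherent`), hence a COKERNEL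
of a morphism of free modules `⨁_J 𝒪 → ⨁_I 𝒪` (Mathlib `presentationTilde`, `Presentation.isColimit`); the
functor `M ⊗ –` is a left adjoint (`Modules/TensorSheafHomAdjunction.isLeftAdjoint_tensorBifunctor_obj`), so it
preserves cokernels and coproducts: `M ⊗ N ≅ coker(M ⊗ ⨁_J 𝒪 → M ⊗ ⨁_I 𝒪)` with `M ⊗ ⨁_I 𝒪 ≅ ⨁_I (M ⊗ 𝒪) ≅ ⨁_I M`
(`Modules/TensorUnitors.tensorUnitRightIso`); on `Spec R` a coproduct of quasi-coherent modules is quasi-coherent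
(`⨁_I Mᵢ ≅ ⨁_I Γ(Mᵢ)~ ≅ (⨁_I Γ(Mᵢ))~`, the functor `~` being a left adjoint, Mathlib `tilde.adjunction`), and a
cokernel of a morphism of quasi-coherent modules is quasi-coherent (tree
`Modules/QuasicoherentAbelian.isQuasicoherent_cokernel`). For a general scheme one restricts to the affine opens:
restriction along an open immersion commutes with the tensor product (`Modules.PullbackTensorObjIso_holds`, Stacks
01CD, through Mathlib's `restrictFunctorIsoPullback`), and quasi-coherence is local (Mathlib
`IsQuasicoherent.of_coversTop`, via the tree's `Modules/PullbackQuasicoherent.isQuasicoherent_over_of_presentation_restrict_fromSpec`).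

* §1 `M ⊗ –` preserves colimits; `M ⊗ ⨁_I 𝒪 ≅ ⨁_I M` (`nonempty_tensorObj_free_iso_sigmaObj`);
* §2 on `Spec R`: `isQuasicoherent_sigmaObj_Spec` (coproducts), `isQuasicoherent_tensorObj_free_Spec`,
  **`isQuasicoherent_tensorObj_Spec`**;
* §3 on any scheme: `nonempty_restrict_tensorObj_iso` (restriction to an open commutes with `⊗`),
  **`isQuasicoherent_tensorObj`**, **`IsAffineLocalizing.tensorObj`** (Stacks 01LA (5) / 01CE for the tree's predicate).

Everything is proved; no named fact. The locally-free special cases already in the tree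
(`Modules/CohTensorObjLocallyFree.IsAffineLocalizing.tensorObj_of_isFiniteLocallyFree`,
`Modules/TensorProductLocallyFree.isFiniteLocallyFree_tensorObj`) are not restated. Library only (cell
`pub-hodge-ring2`, count-neutral module theory; proves nothing about any crux, route or conjecture).

-- TODO(general form): the affine SECTIONS formula of Stacks 01I8 (1) / Hartshorne II Prop. 5.2 (b),
-- `Γ(V, M ⊗ N) ≅ Γ(V, M) ⊗_{Γ(V, 𝒪_X)} Γ(V, N)` on affine `V` via `m ⊗ n ↦ tmulSection m n`, is not typed here
-- (only the quasi-coherence consequence is).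

## References

* The Stacks Project, Tag 01LA (Schemes, Lemma "direct sums, kernels, cokernels, tensor products of quasi-coherent
  modules are quasi-coherent", item (5)), Tag 01CE (Modules, Lemma 17.16.6), Tag 01I8 (1) (`M~ ⊗ N~ = (M ⊗_R N)~`),
  Tag 01CD (pull-back commutes with tensor product), Tag 01CA. [StacksProject]
* R. Hartshorne, *Algebraic Geometry*, GTM 52 (1977), II Prop. 5.2 (b) (p. 110), II Cor. 5.5, II Prop. 5.7. [Hartshorne1977]
* U. Görtz, T. Wedhorn, *Algebraic Geometry I: Schemes*, 2nd ed. (2020), Prop. 7.14 (2), Cor. 7.19. [GortzWedhorn2020]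
-/

noncomputable section

-- `TopCat.Presheaf`/`Scheme.Modules` are not reducible (as in Mathlib's `AlgebraicGeometry/Modules/Sheaf.lean`).
set_option backward.isDefEq.respectTransparency false

open CategoryTheory CategoryTheory.Limits AlgebraicGeometry TopologicalSpace Opposite
open SheafOfModules

universe u

namespace Literature.AlgebraicGeometry.Modules

/-! ### §1 `M ⊗ –` preserves colimits; `M ⊗ ⨁_I 𝒪 ≅ ⨁_I M` -/

section Colimits

variable {X : Scheme.{u}} (M : X.Modules)

/-- **`M ⊗ –` preserves all colimits** (it is a left adjoint, `B ⊗ – ⊣ 𝓗om(B, –)`, Hartshorne II Ex. 5.1 (c)).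
[cite: StacksProject, Tag 01CE] [cite: Hartshorne1977, II Ex. 5.1 (c)] -/
theorem preservesColimitsOfSize_tensorBifunctor_obj :
    PreservesColimitsOfSize.{u, u} ((tensorBifunctor X).obj M) := by
  haveI := isLeftAdjoint_tensorBifunctor_obj M
  infer_instance

/-- **`M ⊗ ⨁_I 𝒪_X ≅ ⨁_I M`**: `M ⊗ –` commutes with coproducts and `M ⊗ 𝒪_X ≅ M` ("the tensor product commutes
with direct sums", Stacks 01CE proof). [cite: StacksProject, Tag 01CE] -/
theorem nonempty_tensorObj_free_iso_sigmaObj (I : Type u) :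
    Nonempty (tensorObj M (free (R := X.ringCatSheaf) I) ≅ ∐ fun _ : I => M) := by
  haveI := preservesColimitsOfSize_tensorBifunctor_obj M
  exact ⟨(PreservesCoproduct.iso ((tensorBifunctor X).obj M) fun _ : I => unit X.ringCatSheaf) ≪≫
    Sigma.mapIso fun _ => tensorUnitRightIso M⟩

end Colimits

/-! ### §2 On an affine scheme: coproducts and tensor products of quasi-coherent modules are quasi-coherent -/

section Affine

variable {R : CommRingCat.{u}}

/-- **On `Spec R`, a coproduct of quasi-coherent modules is quasi-coherent**: `⨁_I Nᵢ ≅ ⨁_I Γ(Nᵢ)~ ≅ (⨁_I Γ(Nᵢ))~`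
(every quasi-coherent module on `Spec R` is `Γ(N)~`, Mathlib `isIso_fromTildeΓ_of_isQuasicoherent`; `~` is a left
adjoint, Mathlib `tilde.adjunction`, so it commutes with coproducts). [cite: StacksProject, Tag 01LA]
[cite: Hartshorne1977, II Prop. 5.2 and Cor. 5.5] -/
theorem isQuasicoherent_sigmaObj_Spec {I : Type u} (N : I → (Spec R).Modules) [∀ i, (N i).IsQuasicoherent] :
    (∐ N).IsQuasicoherent := by
  -- `Nᵢ ≅ Γ(Nᵢ)~`
  haveI : ∀ i, IsIso (N i).fromTildeΓ := fun i => (isQuasicoherent_iff_isIso_fromTildeΓ (N i)).mp inferInstance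
  let e : ∀ i, (tilde.functor R).obj ((modulesSpecToSheaf.obj (N i)).presheaf.obj (op ⊤)) ≅ N i :=
    fun i => asIso (N i).fromTildeΓ
  -- `⨁ Γ(Nᵢ)~ ≅ (⨁ Γ(Nᵢ))~`
  let e' : tilde (∐ fun i => (modulesSpecToSheaf.obj (N i)).presheaf.obj (op ⊤)) ≅ ∐ N :=
    PreservesCoproduct.iso (tilde.functor R) _ ≪≫ Sigma.mapIso e
  have h : (tilde (∐ fun i => (modulesSpecToSheaf.obj (N i)).presheaf.obj (op ⊤))).IsQuasicoherent := inferInstance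
  exact (SheafOfModules.isQuasicoherent (Spec R).ringCatSheaf).prop_of_iso e' h

/-- On `Spec R`, `M ⊗ ⨁_I 𝒪 (≅ ⨁_I M)` is quasi-coherent for `M` quasi-coherent. [cite: StacksProject, Tag 01LA] -/
theorem isQuasicoherent_tensorObj_free_Spec (M : (Spec R).Modules) [M.IsQuasicoherent] (I : Type u) :
    (tensorObj M (free (R := (Spec R).ringCatSheaf) I)).IsQuasicoherent := by
  obtain ⟨e⟩ := nonempty_tensorObj_free_iso_sigmaObj M I
  haveI := isQuasicoherent_sigmaObj_Spec (fun _ : I => M)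
  exact (SheafOfModules.isQuasicoherent (Spec R).ringCatSheaf).prop_of_iso e.symm inferInstance

/-- **On `Spec R`, the tensor product of two quasi-coherent modules is quasi-coherent** (Stacks 01I8 (1) /
Hartshorne II Prop. 5.2 (b), in the form "quasi-coherent"): write `N ≅ Γ(N)~` as a cokernel of
`⨁_J 𝒪 → ⨁_I 𝒪` (Mathlib `presentationTilde`); `M ⊗ –` preserves this cokernel, and `M ⊗ ⨁ 𝒪` is quasi-coherent.
[cite: StacksProject, Tag 01I8] [cite: Hartshorne1977, II Prop. 5.2 (b) (p. 110)] -/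
theorem isQuasicoherent_tensorObj_Spec (M N : (Spec R).Modules) [M.IsQuasicoherent] [N.IsQuasicoherent] :
    (tensorObj M N).IsQuasicoherent := by
  -- a global presentation of `N ≅ Γ(N)~`
  haveI : IsIso N.fromTildeΓ := (isQuasicoherent_iff_isIso_fromTildeΓ N).mp inferInstance
  let P : N.Presentation :=
    Presentation.ofIsIso N.fromTildeΓ (presentationTilde.{u} _ .univ (by simp) _ (Submodule.span_eq _))
  let F : (Spec R).Modules ⥤ (Spec R).Modules := (tensorBifunctor (Spec R)).obj M
  haveI : F.PreservesZeroMorphisms := preservesZeroMorphisms_tensorBifunctor_obj M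
  haveI := preservesColimitsOfSize_tensorBifunctor_obj M
  -- `N = coker (g : free J → free I)`, hence `M ⊗ N = coker (M ⊗ g)`
  let c := CokernelCofork.ofπ (f := (freeHomEquiv _).symm P.relations.s ≫ kernel.ι P.generators.π)
    P.generators.π (by simp)
  let hc : IsColimit (c.map F) := c.mapIsColimit P.isColimit F
  let e : tensorObj M N ≅ cokernel (F.map ((freeHomEquiv _).symm P.relations.s ≫ kernel.ι P.generators.π)) :=
    hc.coconePointUniqueUpToIso (colimit.isColimit _)
  haveI : (F.obj (free P.relations.I)).IsQuasicoherent := isQuasicoherent_tensorObj_free_Spec M _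
  haveI : (F.obj (free P.generators.I)).IsQuasicoherent := isQuasicoherent_tensorObj_free_Spec M _
  haveI := isQuasicoherent_cokernel (F.map ((freeHomEquiv _).symm P.relations.s ≫ kernel.ι P.generators.π))
  exact (SheafOfModules.isQuasicoherent (Spec R).ringCatSheaf).prop_of_iso e.symm inferInstance

end Affine

/-! ### §3 On any scheme -/

section Scheme

variable {X : Scheme.{u}} (M N : X.Modules)

/-- **Restriction to an open commutes with the tensor product**: `(M ⊗ N)|_U ≅ M|_U ⊗ N|_U` for an open immersion
`f : U ⟶ X` (Mathlib's `restrictFunctor f ≅ pullback f` and the tree's `f^*(M ⊗ N) ≅ f^*M ⊗ f^*N`,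
`Modules.PullbackTensorObjIso_holds`, Stacks 01CD). [cite: StacksProject, Tag 01CD] -/
theorem nonempty_restrict_tensorObj_iso {U : Scheme.{u}} (f : U ⟶ X) [IsOpenImmersion f] :
    Nonempty ((tensorObj M N).restrict f ≅ tensorObj (M.restrict f) (N.restrict f)) := by
  obtain ⟨φ⟩ := PullbackTensorObjIso_holds f M
  let r := Scheme.Modules.restrictFunctorIsoPullback f
  exact ⟨r.app (tensorObj M N) ≪≫ φ.app N ≪≫ tensorMapIso (r.app M).symm (r.app N).symm⟩

/-- The affine opens of a scheme cover it (`CoversTop` for the Zariski topology on `X.Opens`; private copy of the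
private lemma of `Modules/QuasicoherentAbelian`). [folklore] -/
private theorem coversTop_affineOpens' (X : Scheme.{u}) :
    (Opens.grothendieckTopology X).CoversTop (fun V : X.affineOpens => (V : X.Opens)) :=
  (Opens.coversTop_iff _ _).mpr (TopologicalSpace.IsOpenCover.mk (iSup_affineOpens_eq_top X))

/-- **The tensor product of two quasi-coherent `𝒪_X`-modules is quasi-coherent** (Stacks 01LA (5) / 01CE;
Hartshorne II Prop. 5.7 context): on each affine open `V`, `(M ⊗ N)|_{Spec Γ(X,V)} ≅ M| ⊗ N|` is quasi-coherent
(`isQuasicoherent_tensorObj_Spec`), hence `≅ Γ(…)~` has a global presentation; quasi-coherence is local.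
[cite: StacksProject, Tag 01LA] [cite: StacksProject, Tag 01CE] [cite: Hartshorne1977, II Prop. 5.2 (b) and Cor. 5.5] -/
theorem isQuasicoherent_tensorObj [M.IsQuasicoherent] [N.IsQuasicoherent] : (tensorObj M N).IsQuasicoherent := by
  haveI : ∀ V : X.affineOpens, ((tensorObj M N).over ((fun V : X.affineOpens => (V : X.Opens)) V)).IsQuasicoherent := by
    intro V
    have hV : IsAffineOpen (V : X.Opens) := V.2
    obtain ⟨e⟩ := nonempty_restrict_tensorObj_iso M N hV.fromSpec
    haveI : (tensorObj (M.restrict hV.fromSpec) (N.restrict hV.fromSpec)).IsQuasicoherent :=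
      isQuasicoherent_tensorObj_Spec _ _
    haveI : IsIso (tensorObj (M.restrict hV.fromSpec) (N.restrict hV.fromSpec)).fromTildeΓ :=
      (isQuasicoherent_iff_isIso_fromTildeΓ _).mp inferInstance
    let P₀ : ((tensorObj M N).restrict hV.fromSpec).Presentation :=
      Presentation.ofIsIso e.inv (Presentation.ofIsIso (tensorObj (M.restrict hV.fromSpec) (N.restrict hV.fromSpec)).fromTildeΓ
        (presentationTilde.{u} _ .univ (by simp) _ (Submodule.span_eq _)))
    exact isQuasicoherent_over_of_presentation_restrict_fromSpec _ hV P₀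
  exact IsQuasicoherent.of_coversTop (tensorObj M N) (fun V : X.affineOpens => (V : X.Opens)) (coversTop_affineOpens' X)

variable {M N}

/-- **Stacks 01LA (5) for the tree's predicate**: `M ⊗ N` is affine-localizing (EGA I 1.4.1 d1), d2) /
Hartshorne II Lemma 5.3) for `M`, `N` affine-localizing. [cite: StacksProject, Tag 01LA] [cite: Hartshorne1977, II Prop. 5.4] -/
theorem IsAffineLocalizing.tensorObj (hM : IsAffineLocalizing M) (hN : IsAffineLocalizing N) :
    IsAffineLocalizing (tensorObj M N) := by
  haveI := isQuasicoherent_of_isAffineLocalizing hM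
  haveI := isQuasicoherent_of_isAffineLocalizing hN
  haveI := isQuasicoherent_tensorObj M N
  exact IsAffineLocalizing.of_isQuasicoherent _

end Scheme

end Literature.AlgebraicGeometry.Modules

end
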